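import Literature.Computability.AlgebraicComplexity.Hyperdeterminant
import Literature.Computability.AlgebraicComplexity.DeterminantalComplexityProofs
import Literature.Computability.AlgebraicComplexity.StandardFamiliesProofs
import Mathlib.Analysis.Complex.Basic

/-!
# `DetqpThesis` (stmt-ValiantsHypothesis-0315), line `Sketch` (idea four-dimensional-determinant) —
# stub S6: `dc(per_n) ≤ dc(HD_n)` for `n ≥ 1`

Write `HD_n := hyperdet (fun I : Fin 4 → Fin n => X I)` for the generic four-dimensional Cayley
hyperdeterminant over `ℂ` (tree `Literature.Computability.AlgebraicComplexity.hyperdet`,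
`HD_n = ∑_{σ₀,σ₁,σ₂,σ₃ ∈ 𝔖_n} (∏_j sgn σ_j) ∏_i x_{σ₀ i, σ₁ i, σ₂ i, σ₃ i}`).  This file proves the
converse bookkeeping of the line: the determinantal complexity of the permanent is at most that
of `HD_n`.

* §1 (the identity, Gurvits 2004, Ex. 3.3: the permanent is the hyperdeterminant of the diagonal
  block tensor).  For an `n × n` matrix `M` over a commutative ring consider the diagonal block
  array `I ↦ [I 2 = I 0] [I 3 = I 1] · M (I 0) (I 1)` (written inline; no definition is
  introduced).  Its hyperdeterminant is `n! · per M` (`hyperdet_blockArr`): the `σ`-term vanishes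
  unless `σ₂ = σ₀` and `σ₃ = σ₁` (`blockArr_term_eq_zero`), the surviving terms are indexed by the
  doubled pairs `(σ₀, σ₁, σ₀, σ₁)`, carry the sign `(sgn σ₀ sgn σ₁)² = 1`, and
  `∏_i M (σ₀ i) (σ₁ i) = ∏_i M ((σ₀ σ₁⁻¹) i) i` is the permanent term of `σ₀ σ₁⁻¹`
  (`blockArr_term_dbl`); summing over `σ₀` at fixed `σ₁` gives `per M`, and then `n!` copies.
* §2 Substituting `x_I ↦ [I 2 = I 0] [I 3 = I 1] X_{I 0, I 1}` (a variable or `0`) is a Valiant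
  projection with `aeval _ HD_n = C n! * PER_n` (`aeval_blockArr_hyperdet`, via `map_hyperdet`),
  so `dc (n! · PER_n) ≤ dc (HD_n)` (`determinantalComplexity_le_of_isProjection_holds`).
* §3 A nonzero scalar does not change `dc` once `dc ≥ 1`: scale the first row of the attained
  representation (`hasDetRepr_C_mul`, the manoeuvre of `AlgDetRepr.lean`); here
  `dc (n! · PER_n) ≥ deg (n! · PER_n) = n ≥ 1`.  Hence
  `dc (PER_n) ≤ dc (n! · PER_n) ≤ dc (HD_n)` (`stub_dc_perPoly_le_dc_hyperdet`).

Sources: L. Gurvits, *Classical complexity and quantum entanglement*, JCSS 69 (2004), Ex. 3.3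
(key `Gurvits2004`); P. Bürgisser, *Completeness and Reduction in Algebraic Complexity Theory*
(2000), §2.5; T. Mignon, N. Ressayre (2004), §1.  Not here: the other stubs of the line
(`HD ∈ VNP`, the completeness transfer, the qp-glue, `¬ qp dc(HD)`).
-/

noncomputable section

-- single-conjunct layout: Sub = Summit, duplicated namespace component intended
set_option linter.dupNamespace false

namespace Summit.ValiantsHypothesis.ValiantsHypothesis.Theorems.DetQPDetqpThesis

open Literature.Computability.AlgebraicComplexity MvPolynomial

section BlockArray

variable {R : Type*} [CommRing R] {n : ℕ}

/-- The term of `hyperdet` of the diagonal block array `I ↦ [I 2 = I 0] [I 3 = I 1] M (I 0) (I 1)`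
at a doubled tuple `(σ₀, σ₁, σ₀, σ₁)` is the permanent term of `σ₀ σ₁⁻¹`: the sign is
`(sgn σ₀ · sgn σ₁)² = 1` and `∏_i M (σ₀ i) (σ₁ i) = ∏_i M ((σ₀ σ₁⁻¹) i) i` (reindex by `σ₁`).
[folklore] -/
theorem blockArr_term_dbl (M : Matrix (Fin n) (Fin n) R)
    (p : Equiv.Perm (Fin n) × Equiv.Perm (Fin n)) :
    (∏ j, (Equiv.Perm.sign ((![p.1, p.2, p.1, p.2] : Fin 4 → Equiv.Perm (Fin n)) j) : R)) *
        ∏ i, (if (![p.1, p.2, p.1, p.2] : Fin 4 → Equiv.Perm (Fin n)) 2 i =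
                (![p.1, p.2, p.1, p.2] : Fin 4 → Equiv.Perm (Fin n)) 0 i ∧
              (![p.1, p.2, p.1, p.2] : Fin 4 → Equiv.Perm (Fin n)) 3 i =
                (![p.1, p.2, p.1, p.2] : Fin 4 → Equiv.Perm (Fin n)) 1 i then
            M ((![p.1, p.2, p.1, p.2] : Fin 4 → Equiv.Perm (Fin n)) 0 i)
              ((![p.1, p.2, p.1, p.2] : Fin 4 → Equiv.Perm (Fin n)) 1 i) else 0) =
      ∏ i, M ((p.1 * p.2⁻¹) i) i := by
  have hs : ∀ τ : Equiv.Perm (Fin n),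
      ((Equiv.Perm.sign τ : ℤˣ) : R) * (Equiv.Perm.sign τ : R) = 1 :=
    fun τ => by rw [← sq]; exact sign_pow_even_cast τ even_two
  rw [Fin.prod_univ_four]
  simp only [Matrix.cons_val_zero, Matrix.cons_val_one, Matrix.cons_val, true_and, if_true]
  rw [show ((Equiv.Perm.sign p.1 : ℤˣ) : R) * (Equiv.Perm.sign p.2 : R) *
      (Equiv.Perm.sign p.1 : R) * (Equiv.Perm.sign p.2 : R) =
      (((Equiv.Perm.sign p.1 : ℤˣ) : R) * (Equiv.Perm.sign p.1 : R)) *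
      ((Equiv.Perm.sign p.2 : R) * (Equiv.Perm.sign p.2 : R)) by ring, hs, hs, one_mul, one_mul]
  rw [← Equiv.prod_comp p.2 (fun i => M ((p.1 * p.2⁻¹) i) i)]
  simp [Equiv.Perm.mul_apply]

/-- Off the doubled tuples the term of `hyperdet` of the diagonal block array vanishes: if `σ` is
not of the form `(σ₀, σ₁, σ₀, σ₁)` then `σ₂ i ≠ σ₀ i` or `σ₃ i ≠ σ₁ i` for some `i`, and the `i`-th
factor is `0`. [folklore] -/
theorem blockArr_term_eq_zero (M : Matrix (Fin n) (Fin n) R) (σ : Fin 4 → Equiv.Perm (Fin n))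
    (hσ : σ ∉ Set.range (fun p : Equiv.Perm (Fin n) × Equiv.Perm (Fin n) =>
      (![p.1, p.2, p.1, p.2] : Fin 4 → Equiv.Perm (Fin n)))) :
    (∏ j, (Equiv.Perm.sign (σ j) : R)) *
        ∏ i, (if σ 2 i = σ 0 i ∧ σ 3 i = σ 1 i then M (σ 0 i) (σ 1 i) else 0) = 0 := by
  obtain ⟨i, hi⟩ : ∃ i, ¬(σ 2 i = σ 0 i ∧ σ 3 i = σ 1 i) := by
    by_contra hcon
    push Not at hcon
    refine hσ ⟨(σ 0, σ 1), funext fun j => ?_⟩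
    have h2 : σ 2 = σ 0 := Equiv.ext fun i => (hcon i).1
    have h3 : σ 3 = σ 1 := Equiv.ext fun i => (hcon i).2
    fin_cases j <;> simp [h2, h3]
  rw [Finset.prod_eq_zero (Finset.mem_univ i) (by rw [if_neg hi]), mul_zero]

/-- **The permanent as a four-dimensional hyperdeterminant** (Gurvits 2004, Ex. 3.3): for every
`n × n` matrix `M` over a commutative ring, the hyperdeterminant of the diagonal block array
`I ↦ [I 2 = I 0] [I 3 = I 1] M (I 0) (I 1)` is `n! · per M`.  Only the doubled tuples
`(σ₀, σ₁, σ₀, σ₁)` contribute (`blockArr_term_eq_zero`, `Fintype.sum_of_injective`), each with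
the permanent term of `σ₀ σ₁⁻¹` (`blockArr_term_dbl`); at fixed `σ₁` the map `σ₀ ↦ σ₀ σ₁⁻¹` is a
bijection of `𝔖_n` (`Equiv.mulRight`), so the inner sum is `per M` and the outer sum contributes
the factor `|𝔖_n| = n!`. [cite: Gurvits2004, Ex. 3.3] -/
theorem hyperdet_blockArr (M : Matrix (Fin n) (Fin n) R) :
    hyperdet (fun I : Fin 4 → Fin n => if I 2 = I 0 ∧ I 3 = I 1 then M (I 0) (I 1) else 0) =
      (n.factorial : R) * M.permanent := by
  have hinj : Function.Injective (fun p : Equiv.Perm (Fin n) × Equiv.Perm (Fin n) =>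
      (![p.1, p.2, p.1, p.2] : Fin 4 → Equiv.Perm (Fin n))) := by
    intro p q h
    have h0 := congrFun h 0
    have h1 := congrFun h 1
    simp only [Matrix.cons_val_zero, Matrix.cons_val_one] at h0 h1
    exact Prod.ext h0 h1
  unfold hyperdet
  beta_reduce
  rw [← Fintype.sum_of_injective _ hinj (fun p => ∏ i, M ((p.1 * p.2⁻¹) i) i) _
    (blockArr_term_eq_zero M) (fun p => (blockArr_term_dbl M p).symm)]
  rw [Fintype.sum_prod_type_right]
  have hinner : ∀ σ1 : Equiv.Perm (Fin n),
      ∑ σ0 : Equiv.Perm (Fin n), ∏ i, M ((σ0 * σ1⁻¹) i) i = M.permanent := fun σ1 => by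
    rw [Matrix.permanent, ← Equiv.sum_comp (Equiv.mulRight σ1⁻¹) (fun π => ∏ i, M (π i) i)]
    rfl
  simp only [hinner]
  rw [Finset.sum_const, Finset.card_univ, Fintype.card_perm, Fintype.card_fin, nsmul_eq_mul]

end BlockArray

/-! ### §2 `n! · PER_n` is a projection of `HD_n` -/

/-- **Step 1 (the substitution).**  Substituting the diagonal block array
`a I = [I 2 = I 0] [I 3 = I 1] X_{I 0, I 1}` of the generic matrix `(X_{ij})` into the generic
hyperdeterminant gives `n! · PER_n`: `aeval a HD_n = hyperdet a = C n! * perPoly (Fin n) ℂ`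
(`map_hyperdet`, `hyperdet_blockArr`; Gurvits 2004, Ex. 3.3). [folklore] -/
theorem aeval_blockArr_hyperdet (n : ℕ) :
    aeval (fun I : Fin 4 → Fin n =>
        if I 2 = I 0 ∧ I 3 = I 1 then (X (I 0, I 1) : MvPolynomial (Fin n × Fin n) ℂ) else 0)
        (hyperdet (fun I : Fin 4 → Fin n => (X I : MvPolynomial (Fin 4 → Fin n) ℂ))) =
      C (n.factorial : ℂ) * perPoly (Fin n) ℂ := by
  rw [show (aeval _ : MvPolynomial (Fin 4 → Fin n) ℂ →ₐ[ℂ] MvPolynomial (Fin n × Fin n) ℂ)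
      (hyperdet _) = (aeval _ : MvPolynomial (Fin 4 → Fin n) ℂ →ₐ[ℂ]
        MvPolynomial (Fin n × Fin n) ℂ).toRingHom (hyperdet _) from rfl, map_hyperdet]
  simp only [AlgHom.toRingHom_eq_coe, RingHom.coe_coe, aeval_X]
  rw [perPoly, map_natCast, ← hyperdet_blockArr (Matrix.mvPolynomialX (Fin n) (Fin n) ℂ)]
  simp only [Matrix.mvPolynomialX_apply]

/-- **Step 2 (projection).**  `n! · PER_n` is a Valiant projection of `HD_n`: every substituted
entry `[I 2 = I 0] [I 3 = I 1] X_{I 0, I 1}` is the variable `X_{I 0, I 1}` or the constant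
`0 = C 0` (Bürgisser 2000, Def. 2.6(1)). [folklore] -/
theorem isProjection_C_mul_perPoly_hyperdet (n : ℕ) :
    IsProjection (C (n.factorial : ℂ) * perPoly (Fin n) ℂ)
      (hyperdet (fun I : Fin 4 → Fin n => (X I : MvPolynomial (Fin 4 → Fin n) ℂ))) := by
  refine ⟨fun I : Fin 4 → Fin n =>
      if I 2 = I 0 ∧ I 3 = I 1 then (X (I 0, I 1) : MvPolynomial (Fin n × Fin n) ℂ) else 0,
    fun I => ?_, (aeval_blockArr_hyperdet n).symm⟩
  by_cases h : I 2 = I 0 ∧ I 3 = I 1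
  · exact Or.inl ⟨(I 0, I 1), by beta_reduce; rw [if_pos h]⟩
  · exact Or.inr ⟨0, by beta_reduce; rw [if_neg h, C_0]⟩

/-- Hence `dc (n! · PER_n) ≤ dc (HD_n)` (`dc` is monotone under projection,
`determinantalComplexity_le_of_isProjection_holds`; Bürgisser 2000, §2.5). [folklore] -/
theorem determinantalComplexity_C_mul_perPoly_le_hyperdet (n : ℕ) :
    determinantalComplexity (C (n.factorial : ℂ) * perPoly (Fin n) ℂ) ≤
      determinantalComplexity
        (hyperdet (fun I : Fin 4 → Fin n => (X I : MvPolynomial (Fin 4 → Fin n) ℂ))) :=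
  determinantalComplexity_le_of_isProjection_holds (isProjection_C_mul_perPoly_hyperdet n)

/-! ### §3 Unit scalars do not change `dc` -/

/-- **Absorbing a constant factor.**  An affine determinantal representation of positive size
`m` of `f` gives one of `C c * f` of the same size: multiply row `0` by the constant `c`
(`Matrix.det_updateRow_smul`; the entries stay affine, `totalDegree_C = 0`).
Mignon–Ressayre 2004, §1. [folklore] -/
theorem hasDetRepr_C_mul {K : Type*} [CommRing K] {τ : Type*} (c : K) {f : MvPolynomial τ K}
    {m : ℕ} (hm : 0 < m) (h : HasDetRepr f m) : HasDetRepr (C c * f) m := by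
  obtain ⟨A, hA, hf⟩ := h
  refine ⟨A.updateRow ⟨0, hm⟩ ((C c : MvPolynomial τ K) • A ⟨0, hm⟩), fun i j => ?_, ?_⟩
  · rw [Matrix.updateRow_apply]
    split_ifs with hi
    · rw [Pi.smul_apply, smul_eq_mul]
      refine (totalDegree_mul _ _).trans ?_
      rw [totalDegree_C, zero_add]
      exact hA _ j
    · exact hA i j
  · rw [Matrix.det_updateRow_smul, Matrix.updateRow_eq_self, hf]

/-- **Step 3 (unit scalar).**  For `n ≥ 1`, `dc (PER_n) ≤ dc (n! · PER_n)`: the attained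
representation of `n! · PER_n` (`hasDetRepr_determinantalComplexity_holds`) has positive size
`m ≥ deg (n! · PER_n) = n ≥ 1` (`totalDegree_le_determinantalComplexity_holds`; `n! · PER_n` is a
nonzero form of degree `n`, `perPoly_isHomogeneous`, `perPoly_ne_zero`, `n! ≠ 0` in `ℂ`), and
scaling its first row by `(n!)⁻¹` (`hasDetRepr_C_mul`) represents `PER_n` in size `m`.
Mignon–Ressayre 2004, §1. [folklore] -/
theorem determinantalComplexity_perPoly_le_C_mul (n : ℕ) (hn : 1 ≤ n) :
    determinantalComplexity (perPoly (Fin n) ℂ) ≤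
      determinantalComplexity (C (n.factorial : ℂ) * perPoly (Fin n) ℂ) := by
  set m := determinantalComplexity (C (n.factorial : ℂ) * perPoly (Fin n) ℂ) with hm
  have hfact : (n.factorial : ℂ) ≠ 0 := by exact_mod_cast Nat.factorial_ne_zero n
  have hrep : HasDetRepr (C (n.factorial : ℂ) * perPoly (Fin n) ℂ) m :=
    hasDetRepr_determinantalComplexity_holds _
  have hm0 : 0 < m := by
    have hhom : (C (n.factorial : ℂ) * perPoly (Fin n) ℂ).IsHomogeneous n := by
      simpa using (isHomogeneous_C (Fin n × Fin n) (n.factorial : ℂ)).mul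
        (perPoly_isHomogeneous (n := Fin n) (k := ℂ))
    have hne : C (n.factorial : ℂ) * perPoly (Fin n) ℂ ≠ 0 :=
      mul_ne_zero (by rwa [Ne, C_eq_zero]) (perPoly_ne_zero (Fin n) ℂ)
    have hdeg := hhom.totalDegree hne
    have hle := totalDegree_le_determinantalComplexity_holds (C (n.factorial : ℂ) * perPoly (Fin n) ℂ)
    omega
  obtain ⟨A, hA, hdet⟩ := hasDetRepr_C_mul ((n.factorial : ℂ)⁻¹) hm0 hrep
  refine determinantalComplexity_le_of_hasDetRepr ⟨A, hA, ?_⟩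
  rw [hdet, ← mul_assoc, ← C_mul, inv_mul_cancel₀ hfact, C_1, one_mul]

/-- **S6 — converse bookkeeping `dc(per_n) ≤ dc(HD_n)` for `n ≥ 1`.**  The substitution
`x_I ↦ [I 2 = I 0] [I 3 = I 1] X_{I 0, I 1}` turns the generic four-dimensional hyperdeterminant
`HD_n` into `n! · PER_n` (Gurvits 2004, Ex. 3.3; `aeval_blockArr_hyperdet`), a projection, so
`dc (n! · PER_n) ≤ dc (HD_n)` (`determinantalComplexity_C_mul_perPoly_le_hyperdet`); and the unit
`n!` is absorbed into one row of a representation of positive size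
(`determinantalComplexity_perPoly_le_C_mul`, which needs `n ≥ 1`: for `n = 0`,
`dc (PER_0) = dc 1 = 0`). [folklore] -/
theorem stub_dc_perPoly_le_dc_hyperdet (n : ℕ) (hn : 1 ≤ n) :
    determinantalComplexity (perPoly (Fin n) ℂ) ≤
      determinantalComplexity
        (hyperdet (fun I : Fin 4 → Fin n => (X I : MvPolynomial (Fin 4 → Fin n) ℂ))) :=
  (determinantalComplexity_perPoly_le_C_mul n hn).trans
    (determinantalComplexity_C_mul_perPoly_le_hyperdet n)

end Summit.ValiantsHypothesis.ValiantsHypothesis.Theorems.DetQPDetqpThesis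

end
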